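import Mathlib
import Literature.Algebra.EuclideanLattices.LLLProofs
import Literature.Algebra.EuclideanLattices.BabaiIntegral
import Literature.Algebra.EuclideanLattices.BabaiResidualNorm
import HarnessLib

/-!
# Lenstra's algorithm in fixed dimension, III: a failed nearest-plane step bounds the lattice width

Topic `Computability/Complexity`, grouping namespace `FixedDimILP`. The heart of Lenstra's algorithm
(Lenstra 1983, §1; Schrijver 1986, Thm. 18.7, with LLL in place of Lenstra's original reduction and
Babai's nearest-plane step as the rounding): after the rounding map of file II, write the image of `ℤ^N`
as the lattice `Λ = {Σ xᵢ b⁰ᵢ}` of an integer basis `B₀` (rows `b⁰ᵢ`) and let `t` be the (scaled) centre.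
Reduce: `B₁` is an LLL-reduced basis of the same lattice, `B₀ = U' B₁` with `U'` integral. Babai's
nearest-plane algorithm on `B₁` returns a lattice vector `y` with `‖y - t‖² ≤ ¼ Σ ‖b̃¹ⱼ‖²`. EITHER `y` is
within the inscribed radius `ρ₀` of `t` — then its preimage is an integer point of the polytope — OR
`ρ₀ < ‖y - t‖`, and then the last Gram–Schmidt vector `b̃ = b̃¹_{N-1}` is long (`Σ ‖b̃¹ⱼ‖² ≤ 2^N ‖b̃‖²` by
LLL), so the functional `x ↦ ⟪Σ xᵢ b⁰ᵢ, b̃⟫ / ‖b̃‖² = (x · U')_{N-1} = c · x`, `c` = last column of `U'`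
(an INTEGER vector, whose integer level sets are the translates of the sublattice spanned by
`b¹₀, …, b¹_{N-2}`), varies by at most `2^N R₀ / ρ₀` over the region `‖Σ xᵢ b⁰ᵢ - t‖ ≤ R₀` containing the
polytope. This file proves exactly that, over `E = EuclideanSpace ℝ (Fin N)` and the tree's
Gram–Schmidt / LLL / Babai vocabulary (`IsLLLReduced`, `Babai.residual`, `Babai.rowsR`):

* `linComb B x = Σ xᵢ • rowsR B i`, `linComb_mul` (`B₀ = U' B₁ ⇒ linComb B₀ x = linComb B₁ (x ᵥ* U')`),
  `vecMul_last_eq_dotProduct` (the last coefficient is `c · x`);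
* `inner_linComb_gramSchmidt_last` — `⟪Σ aⱼ b¹ⱼ, b̃⟫ = a_{N-1} ‖b̃‖²`;
* `sum_sq_norm_gramSchmidt_le` — LLL: `Σⱼ ‖b̃¹ⱼ‖² ≤ N 2^{N-1} ‖b̃‖²`;
* **`abs_sub_dotProduct_le_of_residual_gt`** — the width bound `|c · x - c · x'| ≤ 2^N R₀ / ρ₀`.

## References

* H. W. Lenstra, Jr., *Integer programming with a fixed number of variables*, Math. Oper. Res. 8 (1983)
  538–548, §1 (the two cases; the number of hyperplanes `H + k b_n` meeting the body). [LenstraHW1983]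
* A. Schrijver, *Theory of Linear and Integer Programming*, Wiley 1986, Thm. 18.7 and (46) (the bound
  `2n(n+1)2^{n(n-1)/4}` on the width, via LLL). [Schrijver1986]
* L. Babai, Combinatorica 6 (1986), §3 (nearest plane: `‖y - t‖² ≤ ¼ Σ ‖b̃ⱼ‖²`). [Babai1986]
* A. K. Lenstra, H. W. Lenstra, L. Lovász, Math. Ann. 261 (1982), Prop. 1.6 ((1.7): `‖b̃ⱼ‖² ≤ 2^{i-j}‖b̃ᵢ‖²`).
  [LenstraLenstraLovasz1982]
-/

noncomputable section

namespace Literature.Computability.Complexity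

namespace FixedDimILP

open Finset Matrix InnerProductSpace Literature.Algebra.EuclideanLattices
open scoped RealInnerProductSpace

variable {N : ℕ}

/-! ### Linear combinations of integer rows -/

/-- `Σᵢ xᵢ b⁰ᵢ ∈ ℝ^N` for real coefficients `x` and the integer rows `b⁰ᵢ` of `B` (the real reading of
`x ᵥ* B`). [folklore] -/
def linComb (B : Fin N → Fin N → ℤ) (x : Fin N → ℝ) : EuclideanSpace ℝ (Fin N) :=
  ∑ i, x i • Babai.rowsR B i

/-- Coordinates of `linComb`: `(Σᵢ xᵢ b⁰ᵢ)ⱼ = Σᵢ xᵢ Bᵢⱼ`. [folklore] -/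
theorem linComb_apply (B : Fin N → Fin N → ℤ) (x : Fin N → ℝ) (j : Fin N) :
    linComb B x j = ∑ i, x i * (B i j : ℝ) := by
  simp [linComb, Babai.rowsR, Finset.sum_apply, intVecToEuclidean_apply]

/-- **Change of basis**: if `B₀ = U' B₁` (integer matrices) then `Σ xᵢ b⁰ᵢ = Σⱼ (x U')ⱼ b¹ⱼ`.
[folklore] -/
theorem linComb_mul (U' B₁ : Matrix (Fin N) (Fin N) ℤ) (x : Fin N → ℝ) :
    linComb (U' * B₁) x = linComb B₁ (x ᵥ* U'.map (Int.cast : ℤ → ℝ)) := by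
  ext j
  rw [linComb_apply, linComb_apply]
  simp only [Matrix.mul_apply, Int.cast_sum, Int.cast_mul, Finset.mul_sum, vecMul, dotProduct,
    Matrix.map_apply, Finset.sum_mul]
  rw [Finset.sum_comm]
  refine Finset.sum_congr rfl fun k _ => Finset.sum_congr rfl fun i _ => ?_
  ring

/-- The last coefficient of `x U'` is the dot product with the last column `c` of `U'`. [folklore] -/
theorem vecMul_apply_eq_dotProduct (U' : Matrix (Fin N) (Fin N) ℤ) (x : Fin N → ℝ) (l : Fin N) :
    (x ᵥ* U'.map (Int.cast : ℤ → ℝ)) l = (fun i => (U' i l : ℝ)) ⬝ᵥ x := by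
  simp [vecMul, dotProduct, Matrix.map_apply, mul_comm]

/-- `linComb` is additive/linear in the coefficients: differences. [folklore] -/
theorem linComb_sub (B : Fin N → Fin N → ℤ) (x x' : Fin N → ℝ) :
    linComb B x - linComb B x' = linComb B (x - x') := by
  simp only [linComb, Pi.sub_apply, sub_smul, Finset.sum_sub_distrib]

/-! ### The last Gram–Schmidt coefficient -/

/-- **`⟪Σⱼ aⱼ bⱼ, b̃_last⟫ = a_last ‖b̃_last‖²`** for a linearly independent family: `b̃_last` is orthogonal
to `b₀, …, b_{last-1}` and `⟪b_last, b̃_last⟫ = ‖b̃_last‖²`. [cite: LenstraLenstraLovasz1982, (1.2) (Gram–Schmidt)] -/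
theorem inner_linComb_gramSchmidt_last {k : ℕ} (B : Fin (k + 1) → Fin (k + 1) → ℤ)
    (hli : LinearIndependent ℝ (Babai.rowsR B)) (a : Fin (k + 1) → ℝ) :
    ⟪linComb B a, gramSchmidt ℝ (Babai.rowsR B) (Fin.last k)⟫ =
      a (Fin.last k) * ‖gramSchmidt ℝ (Babai.rowsR B) (Fin.last k)‖ ^ 2 := by
  set f := Babai.rowsR B with hf
  set g := gramSchmidt ℝ f (Fin.last k) with hg
  rw [linComb, sum_inner, Fin.sum_univ_castSucc]
  have hzero : ∀ i : Fin k, ⟪a (Fin.castSucc i) • f (Fin.castSucc i), g⟫ = 0 := by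
    intro i
    rw [real_inner_smul_left, real_inner_comm, hg, gramSchmidt_inv_triangular ℝ f (Fin.castSucc_lt_last i),
      mul_zero]
  rw [Finset.sum_eq_zero fun i _ => hzero i, zero_add, real_inner_smul_left]
  congr 1
  have hne : g ≠ 0 := gramSchmidt_ne_zero _ hli
  have h1 := gsCoeff_self_holds f (Fin.last k) hne
  rw [gsCoeff, div_eq_one_iff_eq (pow_ne_zero 2 (norm_ne_zero_iff.2 hne))] at h1
  rw [← h1]

/-! ### LLL: all Gram–Schmidt vectors are short relative to the last one -/

/-- **LLL82 (1.7) summed**: for a `3/4`-LLL-reduced family on `Fin (k+1)`,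
`Σⱼ ‖b̃ⱼ‖² ≤ (k+1) 2^k ‖b̃_last‖²`. [cite: LenstraLenstraLovasz1982, Prop. 1.6 (1.7)] -/
theorem sum_sq_norm_gramSchmidt_le {V : Type*} [NormedAddCommGroup V] [InnerProductSpace ℝ V] {k : ℕ}
    {b : Fin (k + 1) → V} (h : IsLLLReduced (3 / 4) b) :
    ∑ j, ‖gramSchmidt ℝ b j‖ ^ 2 ≤ (k + 1) * 2 ^ k * ‖gramSchmidt ℝ b (Fin.last k)‖ ^ 2 := by
  have hterm : ∀ j : Fin (k + 1), ‖gramSchmidt ℝ b j‖ ^ 2 ≤ 2 ^ k * ‖gramSchmidt ℝ b (Fin.last k)‖ ^ 2 := by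
    intro j
    have h1 := IsLLLReduced.sq_norm_gramSchmidt_le_two_pow_mul_holds h (Fin.le_last j)
    refine h1.trans (mul_le_mul_of_nonneg_right ?_ (sq_nonneg _))
    exact pow_le_pow_right₀ (by norm_num) (by simp)
  calc ∑ j, ‖gramSchmidt ℝ b j‖ ^ 2 ≤ ∑ _j : Fin (k + 1), 2 ^ k * ‖gramSchmidt ℝ b (Fin.last k)‖ ^ 2 :=
        Finset.sum_le_sum fun j _ => hterm j
    _ = (k + 1) * 2 ^ k * ‖gramSchmidt ℝ b (Fin.last k)‖ ^ 2 := by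
        rw [Finset.sum_const, Finset.card_univ, Fintype.card_fin, nsmul_eq_mul]; push_cast; ring

/-- Hence **a failed nearest-plane step makes the last Gram–Schmidt vector long**: if Babai's residual of
the target `t` exceeds `ρ₀` then `4 ρ₀² < (k+1) 2^k ‖b̃_last‖²`.
[cite: Babai1986, §3] [cite: LenstraHW1983, §1 (second case)] -/
theorem sq_lt_sq_norm_gramSchmidt_last_of_residual_gt {k : ℕ} (B : Fin (k + 1) → Fin (k + 1) → ℤ)
    (hli : LinearIndependent ℝ (Babai.rowsR B)) (hred : IsLLLReduced (3 / 4) (Babai.rowsR B))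
    (t : EuclideanSpace ℝ (Fin (k + 1))) {ρ₀ : ℝ} (hρ₀ : 0 ≤ ρ₀)
    (hfail : ρ₀ < ‖Babai.residual (k + 1) (Babai.rowsR B) t‖) :
    4 * ρ₀ ^ 2 < (k + 1) * 2 ^ k * ‖gramSchmidt ℝ (Babai.rowsR B) (Fin.last k)‖ ^ 2 := by
  have h1 := Babai.norm_residual_sq_le (finrank_euclideanSpace_fin (𝕜 := ℝ) (n := k + 1)) (Babai.rowsR B) hli t
  have h2 := sum_sq_norm_gramSchmidt_le hred
  have h3 : ρ₀ ^ 2 < ‖Babai.residual (k + 1) (Babai.rowsR B) t‖ ^ 2 := pow_lt_pow_left₀ hfail hρ₀ two_ne_zero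
  linarith

/-! ### The width bound -/

/-- **Lenstra's width bound.** Let `B₀ = U' B₁` with `B₁` linearly independent and `3/4`-LLL-reduced, let
`c` be the last column of `U'`, and suppose Babai's nearest-plane residual of `t` with respect to `B₁`
exceeds `ρ₀ > 0`. Then for any `x, x'` with `‖Σ xᵢ b⁰ᵢ - t‖ ≤ R₀` and `‖Σ x'ᵢ b⁰ᵢ - t‖ ≤ R₀`:
`|c · x - c · x'| ≤ 2^{k+1} R₀ / ρ₀`. (`c · x` is the `b¹_last`-coordinate of `Σ xᵢ b⁰ᵢ`, i.e.
`⟪Σ xᵢ b⁰ᵢ, b̃⟫ / ‖b̃‖²`, which moves by at most `2R₀ / ‖b̃‖`, and `‖b̃‖` is large.)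
[cite: LenstraHW1983, §1 (the number of values of the last coordinate)] [cite: Schrijver1986, Thm. 18.7, (46)] -/
theorem abs_sub_dotProduct_le_of_residual_gt {k : ℕ} (B₀ B₁ U' : Matrix (Fin (k + 1)) (Fin (k + 1)) ℤ)
    (hB : B₀ = U' * B₁) (hli : LinearIndependent ℝ (Babai.rowsR B₁)) (hred : IsLLLReduced (3 / 4) (Babai.rowsR B₁))
    (t : EuclideanSpace ℝ (Fin (k + 1))) {ρ₀ R₀ : ℝ} (hρ₀ : 0 < ρ₀)
    (hfail : ρ₀ < ‖Babai.residual (k + 1) (Babai.rowsR B₁) t‖)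
    {x x' : Fin (k + 1) → ℝ} (hx : ‖linComb B₀ x - t‖ ≤ R₀) (hx' : ‖linComb B₀ x' - t‖ ≤ R₀) :
    |(fun i => (U' i (Fin.last k) : ℝ)) ⬝ᵥ x - (fun i => (U' i (Fin.last k) : ℝ)) ⬝ᵥ x'| ≤
      2 ^ (k + 1) * R₀ / ρ₀ := by
  set c : Fin (k + 1) → ℝ := fun i => (U' i (Fin.last k) : ℝ) with hc
  set g := gramSchmidt ℝ (Babai.rowsR B₁) (Fin.last k) with hg
  have hR₀ : 0 ≤ R₀ := (norm_nonneg _).trans hx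
  -- the difference of the two combinations, in the reduced basis
  have hdiff : linComb B₀ x - linComb B₀ x' = linComb B₁ ((x - x') ᵥ* U'.map (Int.cast : ℤ → ℝ)) := by
    rw [linComb_sub, hB, linComb_mul]
  have hlast : ((x - x') ᵥ* U'.map (Int.cast : ℤ → ℝ)) (Fin.last k) = c ⬝ᵥ x - c ⬝ᵥ x' := by
    rw [vecMul_apply_eq_dotProduct, dotProduct_sub]
  have hinner : ⟪linComb B₀ x - linComb B₀ x', g⟫ = (c ⬝ᵥ x - c ⬝ᵥ x') * ‖g‖ ^ 2 := by
    rw [hdiff, hg, inner_linComb_gramSchmidt_last B₁ hli, hlast]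
  -- `|Δ| ‖g‖² ≤ ‖difference‖ ‖g‖ ≤ 2 R₀ ‖g‖`
  have hg0 : g ≠ 0 := gramSchmidt_ne_zero _ hli
  have hgpos : 0 < ‖g‖ := norm_pos_iff.2 hg0
  have hnormdiff : ‖linComb B₀ x - linComb B₀ x'‖ ≤ 2 * R₀ := by
    have : linComb B₀ x - linComb B₀ x' = (linComb B₀ x - t) - (linComb B₀ x' - t) := by abel
    rw [this]
    exact (norm_sub_le _ _).trans (by linarith)
  have hΔ : |c ⬝ᵥ x - c ⬝ᵥ x'| * ‖g‖ ≤ 2 * R₀ := by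
    have hcs := abs_real_inner_le_norm (linComb B₀ x - linComb B₀ x') g
    rw [hinner, abs_mul, abs_of_nonneg (sq_nonneg ‖g‖)] at hcs
    have h1 : |c ⬝ᵥ x - c ⬝ᵥ x'| * ‖g‖ * ‖g‖ ≤ 2 * R₀ * ‖g‖ := by
      calc |c ⬝ᵥ x - c ⬝ᵥ x'| * ‖g‖ * ‖g‖ = |c ⬝ᵥ x - c ⬝ᵥ x'| * ‖g‖ ^ 2 := by ring
        _ ≤ ‖linComb B₀ x - linComb B₀ x'‖ * ‖g‖ := hcs
        _ ≤ 2 * R₀ * ‖g‖ := mul_le_mul_of_nonneg_right hnormdiff hgpos.le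
    exact le_of_mul_le_mul_right h1 hgpos
  -- `‖g‖` is large: `4 ρ₀² < (k+1) 2^k ‖g‖²`
  have hglarge := sq_lt_sq_norm_gramSchmidt_last_of_residual_gt B₁ hli hred t hρ₀.le hfail
  -- combine: `Δ² ‖g‖² ≤ 4 R₀²` and `(k+1) 2^k ≤ 4^{k+1}`
  have hkk : ((k : ℝ) + 1) * 2 ^ k ≤ (2 ^ (k + 1)) ^ 2 := by
    have h1 : ((k : ℝ) + 1) ≤ 2 ^ (k + 1) := by
      have := Nat.lt_two_pow_self (n := k + 1)
      exact_mod_cast this.le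
    have h2 : (2 : ℝ) ^ k ≤ 2 ^ (k + 1) := pow_le_pow_right₀ (by norm_num) (Nat.le_succ k)
    calc ((k : ℝ) + 1) * 2 ^ k ≤ 2 ^ (k + 1) * 2 ^ (k + 1) := mul_le_mul h1 h2 (by positivity) (by positivity)
      _ = (2 ^ (k + 1)) ^ 2 := by ring
  set Δ := |c ⬝ᵥ x - c ⬝ᵥ x'| with hΔdef
  have hΔ0 : 0 ≤ Δ := abs_nonneg _
  have h1 : Δ ^ 2 * ‖g‖ ^ 2 ≤ 4 * R₀ ^ 2 := by nlinarith [hΔ, mul_nonneg hΔ0 hgpos.le]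
  have h2 : 4 * ρ₀ ^ 2 ≤ (2 ^ (k + 1)) ^ 2 * ‖g‖ ^ 2 :=
    (hglarge.trans_le (mul_le_mul_of_nonneg_right hkk (sq_nonneg _))).le
  have h3 : Δ ^ 2 * (4 * ρ₀ ^ 2) ≤ Δ ^ 2 * ((2 ^ (k + 1)) ^ 2 * ‖g‖ ^ 2) := mul_le_mul_of_nonneg_left h2 (sq_nonneg Δ)
  have h4 : (2 ^ (k + 1)) ^ 2 * (Δ ^ 2 * ‖g‖ ^ 2) ≤ (2 ^ (k + 1)) ^ 2 * (4 * R₀ ^ 2) :=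
    mul_le_mul_of_nonneg_left h1 (sq_nonneg _)
  have hsq : (Δ * ρ₀) ^ 2 ≤ (2 ^ (k + 1) * R₀) ^ 2 := by nlinarith [h3, h4]
  have hle : Δ * ρ₀ ≤ 2 ^ (k + 1) * R₀ := (sq_le_sq₀ (by positivity) (by positivity)).1 hsq
  rw [le_div_iff₀ hρ₀]
  exact hle

end FixedDimILP

end Literature.Computability.Complexity
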